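import Literature.Combinatorics.SimpleGraph.ParkingFunctionsAcyclicOrientations
import Literature.Combinatorics.SimpleGraph.GraphRiemannRochExamples
import Literature.Combinatorics.SimpleGraph.CriticalGroupExamples
import HarnessLib

/-!
# A connected graph has a unique maximum `G`-parking function iff it is a tree
# (Benson–Chakrabarty–Tetali 2010, Theorem 3.4, Corollaries 3.5 and 3.6); the `G`-parking
# functions number the spanning trees (Postnikov–Shapiro 2004, Theorem 2.1)

Sources (held, read at the page; statements VERBATIM). B. Benson, D. Chakrabarty, P. Tetali,
*`G`-parking functions, acyclic orientations and spanning trees*, Discrete Math. 310 (2010)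
1340–1353 [BensonChakrabartyTetali2010] (held text `paper:arxiv-0801.1114`, chunk p0007):
«**Theorem 3.4.** Let `G` be a simple, connected graph. Then, for a fixed choice of `q`, `G` has a
unique maximum `G`-parking function if and only if `G` is a tree. *Proof.* If `G` is a tree, then
there is only one parking function with respect to any `q` since `G` has no cycles and, thus, each
vertex can have at most one marked neighbor in the Dhar algorithm. (Note that this is in fact
tautological if one uses the bijection between the parking functions and the spanning trees of
`G`.) Hence there is only one maximum `G`-parking function. The other direction is less obvious.
However, observe that in light of the bijection established in Theorem 3.1, it suffices to show
the following. Whenever `G` is connected and contains a cycle, then there are at least two acyclic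
orientations for `G`, with `q` as the unique source. This is easy to establish (for example, by
considering the standard directed acyclic graph (DAG) representation of the graph), and we leave
the proof as a simple exercise. […] **Corollary 3.5.** A simple, connected graph `G` has a unique
maximum parking function `f` if and only if the range of `f` is a subset of `{−1, 0}`. This
follows from the observation that any tree has a unique parking function and, for any vertex
`v ≠ q`, `f(v) = 0`. **Corollary 3.6.** For every `G`, `|𝒫(G,q)| = 1` if and only if
`|MP(G,q)| = 1`.» A. Postnikov, B. Shapiro, *Trees, parking functions, syzygies, and
deformations of monomial ideals*, Trans. AMS 356 (2004) 3109–3142 [PostnikovShapiro2004] (held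
text `paper:arxiv-math_0301110`, chunk p0005), §2: «**Theorem 2.1.** cf. [Gab1] The number of
`G`-parking functions equals the number `N_G = det L_G` of oriented spanning trees of the digraph
`G`.»

## What is formalised (vocabulary of `ReducedDivisors` / `ParkingFunctionsAcyclicOrientations`:
## a `G`-parking function relative to `q` is a `q`-reduced divisor `D` with `D(q) = −1`, so
## `𝒫(G,q) = {D : IsReduced G q D ∧ D q = −1}` and the maximum ones are
## `MP(G,q) = {D ∈ 𝒫(G,q) : deg D = g − 1}` (`‖f‖ = g`, Proposition 2.3); `orderDivisor G ρ` is
## B–N's `ν_P` for the vertex ranking `ρ`)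

* `isReduced_congr`, `IsReduced.update_base` (being a parking function does not involve the
  value at `q`) and **`card_isReduced_apply_base_eq_card_spanningTrees`** (P–S Theorem 2.1 for
  graphs, in the tree's normalisation: the `G`-parking functions with any fixed value at `q`
  number the spanning trees; from `card_isReduced_eq_card_spanningTrees`);
* trees: **`isReduced_iff_of_isTree`** («any tree has a unique parking function and, for any
  vertex `v ≠ q`, `f(v) = 0`»), `card_parking_of_isTree`;
* graphs with a cycle: `orderDivisor_maximum` (for a `q`-connected ranking, `ν_P ∈ MP(G,q)`) and
  **`exists_maximum_ne_of_not_isTree`** — the «simple exercise»: two maximum parking functions,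
  obtained from a `q`-connected vertex order and the order in which a vertex with two earlier
  neighbours is moved up to just after its earliest neighbour;
* **Theorem 3.4** `card_maximum_eq_one_iff_isTree` (also as `existsUnique_maximum_iff_isTree`),
  `card_parking_eq_one_iff_isTree`, **Corollary 3.6** `card_parking_eq_one_iff_card_maximum_eq_one`,
  **Corollary 3.5** `maximum_unique_iff_forall_eq_zero`.

Theorems only; no `sorry`; no named facts.
-/

open Finset SimpleGraph
open Literature.Combinatorics.SimpleGraph.ChipFiring

namespace Literature.Combinatorics.SimpleGraph.BakerNorine

variable {V : Type*} [Fintype V] [DecidableEq V] {G : SimpleGraph V} [DecidableRel G.Adj]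

/-! ### §1 Parking functions do not see the value at `q`; their number -/

section Base

/-- `q`-reducedness only involves the values off `q` (conditions (P1), (P2) of a `G`-parking
function concern `v ∈ V(G) − {v₀}`). [cite: BakerNorine2007, §3.1] -/
theorem isReduced_congr {q : V} {D D' : V → ℤ} (h : ∀ v, v ≠ q → D v = D' v) :
    IsReduced G q D ↔ IsReduced G q D' := by
  have key : ∀ {D D' : V → ℤ}, (∀ v, v ≠ q → D v = D' v) → IsReduced G q D → IsReduced G q D' :=
    fun h hD => ⟨fun v hv => h v hv ▸ hD.nonneg hv, fun A hA hqA => by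
      obtain ⟨v, hvA, hlt⟩ := hD.2 A hA hqA
      exact ⟨v, hvA, h v (fun hvq => hqA (hvq ▸ hvA)) ▸ hlt⟩⟩
  exact ⟨key h, key fun v hv => (h v hv).symm⟩

/-- Changing the value at `q` keeps a divisor `q`-reduced. [cite: BakerNorine2007, §3.1] -/
theorem IsReduced.update_base {q : V} {D : V → ℤ} (hD : IsReduced G q D) (c : ℤ) :
    IsReduced G q (Function.update D q c) :=
  (isReduced_congr fun _ hv => (Function.update_of_ne hv c D).symm).1 hD

/-- **The `G`-parking functions are counted by the spanning trees** («The number of `G`-parking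
functions equals the number `N_G = det L_G` of […] spanning trees», here for graphs and in the
tree's normalisation — `q`-reduced divisors with any prescribed value `c` at `q`): from the
fixed-degree count `card_isReduced_eq_card_spanningTrees`, since the value at `q` is free.
[cite: PostnikovShapiro2004, Theorem 2.1] [cite: BakerShokrieh2013, §5.2] -/
theorem card_isReduced_apply_base_eq_card_spanningTrees (hG : G.Connected) (q : V) (c : ℤ) :
    Nat.card {D : V → ℤ // IsReduced G q D ∧ D q = c} =
      Nat.card {T : SimpleGraph V // T ≤ G ∧ T.IsTree} := by
  rw [← card_isReduced_eq_card_spanningTrees hG q c]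
  have hsum : ∀ (D : V → ℤ) (a : ℤ),
      ∑ v ∈ univ.erase q, Function.update D q a v = ∑ v ∈ univ.erase q, D v := fun D a =>
    Finset.sum_congr rfl fun v hv => Function.update_of_ne (ne_of_mem_erase hv) a D
  refine Nat.card_congr
    { toFun := fun D => ⟨Function.update D.1 q (c - ∑ v ∈ univ.erase q, D.1 v),
        D.2.1.update_base _, ?_⟩
      invFun := fun D => ⟨Function.update D.1 q c, D.2.1.update_base c,
        Function.update_self q c D.1⟩
      left_inv := fun D => ?_
      right_inv := fun D => ?_ }
  · rw [← Finset.add_sum_erase _ _ (mem_univ q), Function.update_self, hsum]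
    ring
  · apply Subtype.ext
    dsimp only
    rw [Function.update_idem]
    conv_rhs => rw [← Function.update_eq_self q D.1]
    rw [D.2.2]
  · apply Subtype.ext
    dsimp only
    rw [Function.update_idem, hsum]
    conv_rhs => rw [← Function.update_eq_self q D.1]
    congr 1
    have h := D.2.2
    rw [← Finset.add_sum_erase _ _ (mem_univ q)] at h
    omega

end Base

/-! ### §2 Trees: the only parking function is `0` -/

section Trees

/-- **«Any tree has a unique parking function and, for any vertex `v ≠ q`, `f(v) = 0`»**: on a
tree, a divisor is `q`-reduced iff it vanishes off `q` (the genus is `0`, and `0 ≤ ‖f‖ ≤ g`).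
[cite: BensonChakrabartyTetali2010, Corollary 3.5 (proof) and Theorem 3.4 (proof)] -/
theorem isReduced_iff_of_isTree (hT : G.IsTree) {q : V} {D : V → ℤ} :
    IsReduced G q D ↔ ∀ v, v ≠ q → D v = 0 := by
  have hg : genus G = 0 := (genus_eq_zero_iff_isTree hT.1).2 hT
  have key : ∀ {D : V → ℤ}, IsReduced G q D → ∀ v, v ≠ q → D v = 0 := fun {D} hD => by
    have hle := hD.sum_erase_le
    rw [hg] at hle
    have h0 : ∀ v ∈ univ.erase q, 0 ≤ D v := fun v hv => hD.nonneg (ne_of_mem_erase hv)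
    have hzero := (Finset.sum_eq_zero_iff_of_nonneg h0).1 (le_antisymm hle (Finset.sum_nonneg h0))
    exact fun v hv => hzero v (mem_erase.2 ⟨hv, mem_univ v⟩)
  refine ⟨key, fun h => ?_⟩
  obtain ⟨D', -, hD'⟩ := exists_isReduced hT.1 q 0
  exact (isReduced_congr fun v hv => (h v hv).trans (key hD' v hv).symm).2 hD'

/-- On a tree every parking function vanishes off `q`.
[cite: BensonChakrabartyTetali2010, Corollary 3.5 (proof)] -/
theorem IsReduced.eq_zero_of_isTree (hT : G.IsTree) {q : V} {D : V → ℤ} (hD : IsReduced G q D)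
    {v : V} (hv : v ≠ q) : D v = 0 :=
  (isReduced_iff_of_isTree hT).1 hD v hv

/-- «If `G` is a tree, then there is only one parking function with respect to any `q` […] this
is in fact tautological if one uses the bijection between the parking functions and the spanning
trees of `G`»: with any prescribed value at `q`, exactly one `q`-reduced divisor.
[cite: BensonChakrabartyTetali2010, Theorem 3.4 (proof)] -/
theorem card_parking_of_isTree (hT : G.IsTree) (q : V) (c : ℤ) :
    Nat.card {D : V → ℤ // IsReduced G q D ∧ D q = c} = 1 := by
  rw [card_isReduced_apply_base_eq_card_spanningTrees hT.1 q c, card_spanningTrees_of_isTree hT]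

end Trees

/-! ### §3 Graphs with a cycle have two maximum parking functions -/

section Cycle

/-- For a vertex ranking `ρ` with `ρ(q) = 0` in which every `v ≠ q` has an earlier neighbour
(an acyclic orientation with unique source `q`), `ν_P` is a **maximum** parking function:
`q`-reduced, `ν_P(q) = −1`, `deg ν_P = g − 1`.
[cite: BensonChakrabartyTetali2010, Theorem 3.1 (proof)] [cite: BakerNorine2007, Theorem 3.3 (proof)] -/
theorem orderDivisor_maximum {q : V} {ρ : V → ℕ} (hρ : Function.Injective ρ) (hq : ρ q = 0)
    (hconn : ∀ v, v ≠ q → ∃ w, G.Adj v w ∧ ρ w < ρ v) :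
    IsReduced G q (orderDivisor G ρ) ∧ orderDivisor G ρ q = -1 ∧
      ∑ v, orderDivisor G ρ v = genus G - 1 := by
  refine ⟨isReduced_orderDivisor_of_forall_exists q ρ hconn, ?_, sum_orderDivisor G hρ⟩
  rw [orderDivisor_apply]
  have h0 : ({w ∈ G.neighborFinset q | ρ w < ρ q} : Finset V) = ∅ :=
    Finset.filter_eq_empty_iff.2 fun w _ => by rw [hq]; exact Nat.not_lt_zero _
  rw [h0, card_empty]
  rfl

/-- **The «simple exercise» of Theorem 3.4**: «Whenever `G` is connected and contains a cycle,
then there are at least two acyclic orientations for `G`, with `q` as the unique source» — here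
directly as two distinct maximum parking functions `ν_P ≠ ν_{P′}`: take a `q`-connected vertex
order `P`; as `g ≥ 1` some `v ≠ q` has two earlier neighbours, and moving `v` up to just after
its earliest neighbour `u` gives a `q`-connected order `P′` with `ν_{P′}(v) = 0 < ν_P(v)`.
[cite: BensonChakrabartyTetali2010, Theorem 3.4 (proof)] -/
theorem exists_maximum_ne_of_not_isTree (hG : G.Connected) (hT : ¬ G.IsTree) (q : V) :
    ∃ D₁ D₂ : V → ℤ, D₁ ≠ D₂ ∧
      (IsReduced G q D₁ ∧ D₁ q = -1 ∧ ∑ v, D₁ v = genus G - 1) ∧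
      (IsReduced G q D₂ ∧ D₂ q = -1 ∧ ∑ v, D₂ v = genus G - 1) := by
  -- a `q`-connected ranking `ρ` (a burning order of some `q`-reduced divisor)
  obtain ⟨D₀, -, hD₀⟩ := exists_isReduced hG q 0
  obtain ⟨h0, ρ, hρ, hq, hburn⟩ := isReduced_iff_exists_burningOrder.1 hD₀
  have hconn : ∀ v, v ≠ q → ∃ w, G.Adj v w ∧ ρ w < ρ v := fun v hv => by
    have h1 : 0 < #{w ∈ G.neighborFinset v | ρ w < ρ v} := by
      have := hburn v hv; have := h0 v hv; omega
    obtain ⟨w, hw⟩ := Finset.card_pos.1 h1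
    exact ⟨w, (mem_neighborFinset G v w).1 (mem_filter.1 hw).1, (mem_filter.1 hw).2⟩
  have hmax := orderDivisor_maximum hρ hq hconn
  -- `g ≥ 1`, so some `v ≠ q` has `ν_P(v) ≥ 1`, i.e. at least two earlier neighbours
  have hg : 1 ≤ genus G := by
    have h1 := genus_nonneg G hG
    have h2 : genus G ≠ 0 := fun h => hT ((genus_eq_zero_iff_isTree hG).1 h)
    omega
  have hsum : ∑ v ∈ univ.erase q, orderDivisor G ρ v = genus G := by
    have h := hmax.2.2
    rw [← Finset.add_sum_erase _ _ (mem_univ q), hmax.2.1] at h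
    omega
  obtain ⟨v, hvq, hvpos⟩ : ∃ v ∈ univ.erase q, (0 : ℤ) < orderDivisor G ρ v := by
    apply Finset.exists_lt_of_sum_lt
    rw [Finset.sum_const_zero, hsum]
    omega
  have hvq' : v ≠ q := ne_of_mem_erase hvq
  rw [orderDivisor_apply] at hvpos
  -- the earliest neighbour `u` of `v`
  have hne : ({w ∈ G.neighborFinset v | ρ w < ρ v} : Finset V).Nonempty := by
    rw [← Finset.card_pos]; omega
  obtain ⟨u, hu, humin⟩ := Finset.exists_min_image _ ρ hne
  have huv : G.Adj v u := (mem_neighborFinset G v u).1 (mem_filter.1 hu).1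
  have hulv : ρ u < ρ v := (mem_filter.1 hu).2
  have humin' : ∀ w, G.Adj v w → ρ u ≤ ρ w := fun w hw => by
    by_cases h : ρ w < ρ v
    · exact humin w (mem_filter.2 ⟨(mem_neighborFinset G v w).2 hw, h⟩)
    · omega
  -- the modified ranking: `v` moved up to just after `u`
  set ρ' : V → ℕ := fun w => if w = v then 2 * ρ u + 1 else 2 * ρ w with hρ'_def
  have hρ'v : ρ' v = 2 * ρ u + 1 := by simp [hρ'_def]
  have hρ'w : ∀ w, w ≠ v → ρ' w = 2 * ρ w := fun w hw => by simp [hρ'_def, hw]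
  have hρ' : Function.Injective ρ' := by
    intro w₁ w₂ h
    by_cases h₁ : w₁ = v <;> by_cases h₂ : w₂ = v
    · rw [h₁, h₂]
    · rw [h₁, hρ'v, hρ'w w₂ h₂] at h; omega
    · rw [h₂, hρ'v, hρ'w w₁ h₁] at h; omega
    · rw [hρ'w w₁ h₁, hρ'w w₂ h₂] at h
      exact hρ (by omega)
  have hq' : ρ' q = 0 := by rw [hρ'w q hvq'.symm, hq]
  have hconn' : ∀ w, w ≠ q → ∃ x, G.Adj w x ∧ ρ' x < ρ' w := by
    intro w hw
    by_cases hwv : w = v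
    · subst hwv
      exact ⟨u, huv, by rw [hρ'v, hρ'w u huv.ne.symm]; omega⟩
    · obtain ⟨x, hwx, hx⟩ := hconn w hw
      refine ⟨x, hwx, ?_⟩
      rw [hρ'w w hwv]
      by_cases hxv : x = v
      · subst hxv; rw [hρ'v]; omega
      · rw [hρ'w x hxv]; omega
  have hmax' := orderDivisor_maximum hρ' hq' hconn'
  -- in the new order `v` has `u` as its only earlier neighbour
  have hone : ({w ∈ G.neighborFinset v | ρ' w < ρ' v} : Finset V) = {u} := by
    refine Finset.eq_singleton_iff_unique_mem.2 ⟨?_, fun w hw => ?_⟩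
    · refine mem_filter.2 ⟨(mem_neighborFinset G v u).2 huv, ?_⟩
      rw [hρ'v, hρ'w u huv.ne.symm]; omega
    · have hvw : G.Adj v w := (mem_neighborFinset G v w).1 (mem_filter.1 hw).1
      have hlt := (mem_filter.1 hw).2
      rw [hρ'v, hρ'w w hvw.ne.symm] at hlt
      have hle := humin' w hvw
      exact hρ (by omega)
  refine ⟨orderDivisor G ρ, orderDivisor G ρ', fun heq => ?_, hmax, hmax'⟩
  have hv := congrFun heq v
  rw [orderDivisor_apply, orderDivisor_apply, hone, card_singleton] at hv
  omega

end Cycle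

/-! ### §4 Theorem 3.4 and Corollaries 3.5, 3.6 -/

section Main

/-- **Theorem 3.4.** «Let `G` be a simple, connected graph. Then, for a fixed choice of `q`, `G`
has a unique maximum `G`-parking function if and only if `G` is a tree.»
[cite: BensonChakrabartyTetali2010, Theorem 3.4] -/
theorem card_maximum_eq_one_iff_isTree (hG : G.Connected) (q : V) :
    Nat.card {D : V → ℤ // IsReduced G q D ∧ D q = -1 ∧ ∑ v, D v = genus G - 1} = 1 ↔
      G.IsTree := by
  rw [Nat.card_eq_one_iff_unique]
  constructor
  · rintro ⟨hsub, -⟩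
    by_contra hT
    obtain ⟨D₁, D₂, hne, h₁, h₂⟩ := exists_maximum_ne_of_not_isTree hG hT q
    exact hne (congrArg Subtype.val (hsub.elim ⟨D₁, h₁⟩ ⟨D₂, h₂⟩))
  · intro hT
    refine ⟨⟨fun D₁ D₂ => Subtype.ext (funext fun v => ?_)⟩, ?_⟩
    · by_cases hv : v = q
      · rw [hv, D₁.2.2.1, D₂.2.2.1]
      · rw [D₁.2.1.eq_zero_of_isTree hT hv, D₂.2.1.eq_zero_of_isTree hT hv]
    · obtain ⟨D, hD, hq, hsum⟩ := exists_isReduced_sum_erase_eq hG q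
      refine ⟨⟨D, hD, hq, ?_⟩⟩
      rw [← Finset.add_sum_erase _ _ (mem_univ q), hq, hsum]
      ring

/-- Theorem 3.4 in `∃!` form. [cite: BensonChakrabartyTetali2010, Theorem 3.4] -/
theorem existsUnique_maximum_iff_isTree (hG : G.Connected) (q : V) :
    (∃! D : V → ℤ, IsReduced G q D ∧ D q = -1 ∧ ∑ v, D v = genus G - 1) ↔ G.IsTree := by
  rw [← card_maximum_eq_one_iff_isTree hG q, Nat.card_eq_one_iff_unique]
  constructor
  · rintro ⟨D, hD, huniq⟩
    exact ⟨⟨fun D₁ D₂ => Subtype.ext ((huniq D₁.1 D₁.2).trans (huniq D₂.1 D₂.2).symm)⟩,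
      ⟨⟨D, hD⟩⟩⟩
  · rintro ⟨hsub, ⟨D⟩⟩
    exact ⟨D.1, D.2, fun D' hD' => congrArg Subtype.val (hsub.elim ⟨D', hD'⟩ D)⟩

/-- A connected graph has exactly one `G`-parking function (relative to `q`) iff it is a tree.
[cite: BensonChakrabartyTetali2010, Theorem 3.4 with Corollary 3.6] -/
theorem card_parking_eq_one_iff_isTree (hG : G.Connected) (q : V) :
    Nat.card {D : V → ℤ // IsReduced G q D ∧ D q = -1} = 1 ↔ G.IsTree := by
  refine ⟨fun h => ?_, fun hT => card_parking_of_isTree hT q (-1)⟩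
  by_contra hT
  obtain ⟨D₁, D₂, hne, h₁, h₂⟩ := exists_maximum_ne_of_not_isTree hG hT q
  have hsub := (Nat.card_eq_one_iff_unique.1 h).1
  exact hne (congrArg Subtype.val (hsub.elim ⟨D₁, h₁.1, h₁.2.1⟩ ⟨D₂, h₂.1, h₂.2.1⟩))

/-- **Corollary 3.6.** «For every `G`, `|𝒫(G,q)| = 1` if and only if `|MP(G,q)| = 1`.»
[cite: BensonChakrabartyTetali2010, Corollary 3.6] -/
theorem card_parking_eq_one_iff_card_maximum_eq_one (hG : G.Connected) (q : V) :
    Nat.card {D : V → ℤ // IsReduced G q D ∧ D q = -1} = 1 ↔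
      Nat.card {D : V → ℤ // IsReduced G q D ∧ D q = -1 ∧ ∑ v, D v = genus G - 1} = 1 := by
  rw [card_parking_eq_one_iff_isTree hG q, card_maximum_eq_one_iff_isTree hG q]

/-- **Corollary 3.5.** «A simple, connected graph `G` has a unique maximum parking function `f`
if and only if the range of `f` is a subset of `{−1, 0}`»: a maximum parking function `f` is the
only one iff `f(v) = 0` for all `v ≠ q` (and `f(q) = −1`).
[cite: BensonChakrabartyTetali2010, Corollary 3.5] -/
theorem maximum_unique_iff_forall_eq_zero (hG : G.Connected) {q : V} {D : V → ℤ}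
    (hD : IsReduced G q D) (hq : D q = -1) (hsum : ∑ v, D v = genus G - 1) :
    (∀ D' : V → ℤ, IsReduced G q D' → D' q = -1 → ∑ v, D' v = genus G - 1 → D' = D) ↔
      ∀ v, v ≠ q → D v = 0 := by
  constructor
  · intro huniq
    have hT : G.IsTree := by
      by_contra hT
      obtain ⟨D₁, D₂, hne, h₁, h₂⟩ := exists_maximum_ne_of_not_isTree hG hT q
      exact hne ((huniq D₁ h₁.1 h₁.2.1 h₁.2.2).trans (huniq D₂ h₂.1 h₂.2.1 h₂.2.2).symm)
    exact fun v hv => hD.eq_zero_of_isTree hT hv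
  · intro h0 D' hD' hq' _
    -- the range condition forces `g = 0`, i.e. `G` is a tree
    have hg : genus G = 0 := by
      rw [← Finset.add_sum_erase _ _ (mem_univ q), hq,
        Finset.sum_eq_zero (fun v hv => h0 v (ne_of_mem_erase hv))] at hsum
      omega
    have hT : G.IsTree := (genus_eq_zero_iff_isTree hG).1 hg
    funext v
    by_cases hv : v = q
    · rw [hv, hq, hq']
    · rw [hD'.eq_zero_of_isTree hT hv, h0 v hv]

end Main

end Literature.Combinatorics.SimpleGraph.BakerNorine
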